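import Literature.RingTheory.TightClosure.RegularTightlyClosed
import Summits.ResolutionOfSingularities.ResolutionOfSingularities.Theorems.FrobeniusLadderFRationalResolutionSuspensionCoeff
import Summits.ResolutionOfSingularities.ResolutionOfSingularities.Theorems.FrobeniusLadderFRationalResolutionSuspensionPowExpand
import Mathlib.RingTheory.MvPolynomial.Ideal
import Mathlib.RingTheory.Filtration
import Mathlib.Algebra.Order.Archimedean.Basic
import HarnessLib

/-!
# Suspension calibration, I: maximal-ideal bookkeeping in `A[y,z]`

Support file for crux stmt-ResolutionOfSingularities-15317 (`FrobeniusLadder.FRationalResolution`),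
line `Sketch`, continuation seat c2 — the by-product SUSPENSION CALIBRATION: for every field `k` of
characteristic `p` and every `f ≠ 0` in `k[x₁..xₙ]`, the hyperbolic suspension `Σf = {yz + f = 0}`
lies in the residual class of the crux (every local ring a domain with every ideal tightly closed).

This file is the bookkeeping that turns the coefficient identity (`stub_suspensionCoeff`, with the
characteristic-`p` expansion `stub_suspension_pow_expand`) into Glassbrenner's elementwise
non-membership at the maximal ideals `M = 𝔞·A[y,z] + (y, z)` of `A[y,z]` (`A = k[x]`, `𝔞 ⊂ A`):

* `mem_iff_C_constantCoeff_mem` — membership in an ideal containing `y, z` is decided on the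
  constant coefficient;
* `coeff_mem_of_mem_map_C_sup` — coefficients at exponents `< q` of elements of
  `𝔟·A[y,z] + (y^q, z^q)` lie in `𝔟`;
* `frobeniusPower_map_C_sup_le` — `(𝔞·A[y,z] + (y,z))^[q] ≤ 𝔞^[q]·A[y,z] + (y^q, z^q)`;
* `comap_constantCoeff_eq` — `𝔞·A[y,z] + (y,z)` is the preimage of `𝔞` under `y, z ↦ 0`;
* `exists_notMem_frobeniusPower_ker` — MAIN LEMMA: if some Laurent coefficient
  `T_D(c) = [T^D] c(T, −f/T)` is non-zero then `c·(yz+f)^(q−1) ∉ M^[q]` for `q = p^e ≫ 0`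
  (the `y^U z^V`-coefficient is `± f^(D⁺) T_D(c)`, which escapes `𝔞^[q] ⊆ 𝔞^q` by Krull's
  intersection theorem in the Noetherian domain `A`).

References: Glassbrenner, Proc. AMS 124 (1996) 345–353 (the criterion being fed); Fedder 1983
(doi:10.2307/1999165); Huneke–Swanson 2006, Thm. 13.1.2; calibration note
`Cruxes/FRationalResolution/NEGATIVE-suspension-calibration.md`.
-/

-- single-problem summit: the doubled namespace component `ResolutionOfSingularities` is forced
set_option linter.dupNamespace false

noncomputable section

open Literature.RingTheory.TightClosure
open scoped BigOperators

namespace Summit.ResolutionOfSingularities.ResolutionOfSingularities.Theorems.FRationalResolution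

/-! ## L1: maximal-ideal bookkeeping in `A[y,z] = MvPolynomial (Fin 2) A` -/

section L1

open MvPolynomial

variable {A : Type} [CommRing A]

/-- A polynomial of `A[y,z]` lies in an ideal containing `y` and `z` iff its constant coefficient
(embedded by `C`) does: `h − C(h(0)) ∈ (y, z)`. -/
theorem mem_iff_C_constantCoeff_mem {J : Ideal (MvPolynomial (Fin 2) A)}
    (h0 : (X 0 : MvPolynomial (Fin 2) A) ∈ J) (h1 : (X 1 : MvPolynomial (Fin 2) A) ∈ J)
    (h : MvPolynomial (Fin 2) A) : h ∈ J ↔ C (constantCoeff h) ∈ J := by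
  have hdiff : h - C (constantCoeff h) ∈ J := by
    have hmem : h - C (constantCoeff h) ∈ Ideal.span (X '' (Set.univ : Set (Fin 2))) := by
      rw [mem_ideal_span_X_image]
      intro m hm
      by_contra hcon
      push Not at hcon
      have hm0 : m = 0 := by
        ext i
        simpa using hcon i (Set.mem_univ i)
      subst hm0
      rw [mem_support_iff, coeff_sub, coeff_C, if_pos rfl, ← constantCoeff_eq, sub_self] at hm
      exact hm rfl
    refine (Ideal.span_le.mpr ?_) hmem
    rintro _ ⟨i, -, rfl⟩
    fin_cases i
    · exact h0
    · exact h1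
  constructor
  · intro hh
    simpa using J.sub_mem hh hdiff
  · intro hC
    simpa using J.add_mem hdiff hC

/-- Coefficient extraction: if `h ∈ 𝔟·A[y,z] + (y^q, z^q)` then every coefficient of `h` at an
exponent `(a, b)` with `a, b < q` lies in `𝔟`. -/
theorem coeff_mem_of_mem_map_C_sup (𝔟 : Ideal A) (q : ℕ) (h : MvPolynomial (Fin 2) A)
    (hh : h ∈ 𝔟.map (C : A →+* MvPolynomial (Fin 2) A) ⊔
      Ideal.span {(X 0 : MvPolynomial (Fin 2) A) ^ q, X 1 ^ q})
    (m : Fin 2 →₀ ℕ) (hm0 : m 0 < q) (hm1 : m 1 < q) : coeff m h ∈ 𝔟 := by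
  obtain ⟨a, ha, b, hb, rfl⟩ := Submodule.mem_sup.mp hh
  rw [coeff_add]
  have ha' : coeff m a ∈ 𝔟 := (mem_map_C_iff.mp ha) m
  have hb' : coeff m b = 0 := by
    rw [Ideal.mem_span_insert] at hb
    obtain ⟨r, b', hb', rfl⟩ := hb
    obtain ⟨s, rfl⟩ := Ideal.mem_span_singleton'.mp hb'
    have hX : ∀ (i : Fin 2) (r : MvPolynomial (Fin 2) A), m i < q →
        coeff m (r * X i ^ q) = 0 := by
      intro i r hi
      rw [X_pow_eq_monomial, coeff_mul_monomial', if_neg]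
      · intro hle
        have := hle i
        simp at this
        omega
    rw [coeff_add, hX 0 r hm0, hX 1 s hm1, add_zero]
  rw [hb', add_zero]
  exact ha'

variable (p : ℕ) [Fact p.Prime] [CharP A p]

/-- The Frobenius power of `𝔞·A[y,z] + (y, z)` is contained in `𝔞^[q]·A[y,z] + (y^q, z^q)`. -/
theorem frobeniusPower_map_C_sup_le (𝔞 : Ideal A) (e : ℕ) :
    frobeniusPower (p ^ e) (𝔞.map (C : A →+* MvPolynomial (Fin 2) A) ⊔
        Ideal.span {(X 0 : MvPolynomial (Fin 2) A), X 1}) ≤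
      (frobeniusPower (p ^ e) 𝔞).map (C : A →+* MvPolynomial (Fin 2) A) ⊔
        Ideal.span {(X 0 : MvPolynomial (Fin 2) A) ^ p ^ e, X 1 ^ p ^ e} := by
  -- Frobenius powers commute with extension along `C` (both are spans of images; this is
  -- `Fedder.frobeniusPower_map` of the stmt-15315 line, inlined to keep imports light)
  have hmap : frobeniusPower (p ^ e) (𝔞.map (C : A →+* MvPolynomial (Fin 2) A)) =
      (frobeniusPower (p ^ e) 𝔞).map (C : A →+* MvPolynomial (Fin 2) A) := by
    rw [frobeniusPower_eq_map_iterateFrobenius, frobeniusPower_eq_map_iterateFrobenius, Ideal.map_map,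
      Ideal.map_map]
    congr 1
    ext a
    simp only [RingHom.coe_comp, Function.comp_apply, iterateFrobenius_def, map_pow]
  rw [frobeniusPower_eq_map_iterateFrobenius, Ideal.map_sup, ← frobeniusPower_eq_map_iterateFrobenius,
    ← frobeniusPower_eq_map_iterateFrobenius, hmap, frobeniusPower_span]
  refine sup_le_sup_left (le_of_eq ?_) _
  congr 1
  ext x
  simp [Set.image_insert_eq, Set.image_singleton]

/-- The ideal `𝔞·A[y,z] + (y, z)` is the preimage of `𝔞` under the constant coefficient
`A[y,z] → A` (`y, z ↦ 0`). -/
theorem comap_constantCoeff_eq (𝔞 : Ideal A) :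
    𝔞.comap (constantCoeff : MvPolynomial (Fin 2) A →+* A) =
      𝔞.map (C : A →+* MvPolynomial (Fin 2) A) ⊔ Ideal.span {(X 0 : MvPolynomial (Fin 2) A), X 1} := by
  have hX0 : (X 0 : MvPolynomial (Fin 2) A) ∈ 𝔞.map (C : A →+* MvPolynomial (Fin 2) A) ⊔
      Ideal.span {(X 0 : MvPolynomial (Fin 2) A), X 1} :=
    Ideal.mem_sup_right (Ideal.subset_span (by simp))
  have hX1 : (X 1 : MvPolynomial (Fin 2) A) ∈ 𝔞.map (C : A →+* MvPolynomial (Fin 2) A) ⊔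
      Ideal.span {(X 0 : MvPolynomial (Fin 2) A), X 1} :=
    Ideal.mem_sup_right (Ideal.subset_span (by simp))
  ext h
  rw [Ideal.mem_comap, mem_iff_C_constantCoeff_mem hX0 hX1]
  constructor
  · intro hh
    exact Ideal.mem_sup_left (Ideal.mem_map_of_mem _ hh)
  · intro hh
    have key : ∀ x ∈ 𝔞.map (C : A →+* MvPolynomial (Fin 2) A) ⊔
        Ideal.span {(X 0 : MvPolynomial (Fin 2) A), X 1}, constantCoeff x ∈ 𝔞 := by
      intro x hx
      obtain ⟨a, ha, b, hb, rfl⟩ := Submodule.mem_sup.mp hx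
      rw [map_add]
      refine 𝔞.add_mem ?_ ?_
      · have := (mem_map_C_iff.mp ha) 0
        simpa [constantCoeff_eq] using this
      · rw [Ideal.mem_span_insert] at hb
        obtain ⟨r, b', hb', rfl⟩ := hb
        obtain ⟨s, rfl⟩ := Ideal.mem_span_singleton'.mp hb'
        simp
    simpa using key _ hh

/-- **Main bookkeeping lemma.** `A` a Noetherian domain of characteristic `p`, `f ≠ 0`, `𝔞 ⊊ A`
an ideal, `M = 𝔞·A[y,z] + (y,z)`, the preimage of `𝔞` under `y, z ↦ 0`. If some Laurent coefficient
`T_D(c) = Σ_{m₀−m₁=D} (−1)^(m₁) c_m f^(m₁)` of `c` is non-zero, then for `q = p^e` large,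
`c·(yz+f)^(q−1) ∉ M^[q]`: its `y^U z^V`-coefficient (`(U,V) = (q−1, q−1−D)` resp. `(q−1+D, q−1)`)
is `± f^(D⁺)·T_D(c)`, a fixed non-zero element, which escapes `𝔞^[q] ⊆ 𝔞^q` for `q ≫ 0` by
Krull's intersection theorem. -/
theorem exists_notMem_frobeniusPower_ker [IsDomain A] [IsNoetherianRing A] (f : A) (hf : f ≠ 0)
    (𝔞 : Ideal A) (h𝔞 : 𝔞 ≠ ⊤) (c : MvPolynomial (Fin 2) A) (D : ℤ)
    (hD : (∑ m ∈ c.support with ((m 0 : ℤ) - (m 1 : ℤ) = D),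
      (-1) ^ (m 1) * coeff m c * f ^ (m 1)) ≠ 0) :
    ∃ e : ℕ, c * (X 0 * X 1 + C f) ^ (p ^ e - 1) ∉
      frobeniusPower (p ^ e) (𝔞.comap (constantCoeff : MvPolynomial (Fin 2) A →+* A)) := by
  have hp := (Fact.out : p.Prime)
  -- the degree bound `B` on the exponents of `c`
  set B : ℕ := (c.support.sup fun m => m 0) + (c.support.sup fun m => m 1) + 1 with hB
  have hBc : ∀ m ∈ c.support, m 0 < B ∧ m 1 < B := by
    intro m hm
    have h0 : m 0 ≤ c.support.sup fun m => m 0 := Finset.le_sup (f := fun m => m 0) hm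
    have h1 : m 1 ≤ c.support.sup fun m => m 1 := Finset.le_sup (f := fun m => m 1) hm
    constructor <;> omega
  -- `D = d` or `D = -d`
  obtain ⟨d, hdD⟩ := Int.eq_nat_or_neg D
  -- the fixed non-zero element `E`
  set T := (∑ m ∈ c.support with ((m 0 : ℤ) - (m 1 : ℤ) = D),
      (-1) ^ (m 1) * coeff m c * f ^ (m 1)) with hT
  have hE : f ^ d * T ≠ 0 := mul_ne_zero (pow_ne_zero _ hf) hD
  -- Krull: some power of `𝔞` misses `T` and `f^d T`
  have hKrull : (⨅ i : ℕ, 𝔞 ^ i) = ⊥ := Ideal.iInf_pow_eq_bot_of_isDomain 𝔞 h𝔞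
  have hN : ∃ N : ℕ, T ∉ 𝔞 ^ N ∧ f ^ d * T ∉ 𝔞 ^ N := by
    by_contra hcon
    push Not at hcon
    have h1 : ∃ N1 : ℕ, T ∉ 𝔞 ^ N1 := by
      by_contra h; push Not at h
      exact hD (by simpa [hKrull] using (Ideal.mem_iInf.mpr h : T ∈ ⨅ i : ℕ, 𝔞 ^ i))
    have h2 : ∃ N2 : ℕ, f ^ d * T ∉ 𝔞 ^ N2 := by
      by_contra h; push Not at h
      exact hE (by simpa [hKrull] using (Ideal.mem_iInf.mpr h : f ^ d * T ∈ ⨅ i : ℕ, 𝔞 ^ i))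
    obtain ⟨N1, hN1⟩ := h1
    obtain ⟨N2, hN2⟩ := h2
    have := hcon (max N1 N2) (fun h => hN1 (Ideal.pow_le_pow_right (le_max_left _ _) h))
    exact hN2 (Ideal.pow_le_pow_right (le_max_right _ _) this)
  obtain ⟨N, hNT, hNE⟩ := hN
  -- choose `q = p^e` beyond `N`, `d`, `B`
  obtain ⟨e, he⟩ := pow_unbounded_of_one_lt (max N (max d B)) hp.one_lt
  have hNq : N ≤ p ^ e := le_of_lt (lt_of_le_of_lt (le_max_left _ _) he)
  have hdq : d < p ^ e := lt_of_le_of_lt ((le_max_left _ _).trans (le_max_right _ _)) he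
  have hBq : B < p ^ e := lt_of_le_of_lt ((le_max_right _ _).trans (le_max_right _ _)) he
  have hcq : ∀ m ∈ c.support, m 0 < p ^ e ∧ m 1 < p ^ e := fun m hm =>
    ⟨(hBc m hm).1.trans hBq, (hBc m hm).2.trans hBq⟩
  refine ⟨e, fun hmem => ?_⟩
  -- move to `𝔞^[q]·A[y,z] + (y^q, z^q)`
  rw [comap_constantCoeff_eq] at hmem
  have hmem' := frobeniusPower_map_C_sup_le p 𝔞 e hmem
  have hcoeff := stub_suspensionCoeff A f c (p ^ e) d hdq hcq
    (stub_suspension_pow_expand p A f e)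
  have hfrob_le : frobeniusPower (p ^ e) 𝔞 ≤ 𝔞 ^ N :=
    (frobeniusPower_le_pow (p ^ e) 𝔞).trans (Ideal.pow_le_pow_right hNq)
  have hunit : ∀ k : ℕ, IsUnit ((-1 : A) ^ k) := fun k => (isUnit_neg_one (α := A)).pow k
  rcases hdD with rfl | rfl
  · -- `D = d`: coefficient at `(q-1, q-1-d)`
    have h1 := coeff_mem_of_mem_map_C_sup (frobeniusPower (p ^ e) 𝔞) (p ^ e) _ hmem'
      (Finsupp.single 0 (p ^ e - 1) + Finsupp.single 1 (p ^ e - 1 - d))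
      (by simp; omega) (by simp; omega)
    rw [hcoeff.1, mul_assoc] at h1
    exact hNE (hfrob_le ((Ideal.unit_mul_mem_iff_mem _ (hunit _)).mp h1))
  · -- `D = -d`: coefficient at `(q-1-d, q-1)`
    have h1 := coeff_mem_of_mem_map_C_sup (frobeniusPower (p ^ e) 𝔞) (p ^ e) _ hmem'
      (Finsupp.single 0 (p ^ e - 1 - d) + Finsupp.single 1 (p ^ e - 1))
      (by simp; omega) (by simp; omega)
    rw [hcoeff.2] at h1
    exact hNT (hfrob_le ((Ideal.unit_mul_mem_iff_mem _ (hunit _)).mp h1))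

end L1

end Summit.ResolutionOfSingularities.ResolutionOfSingularities.Theorems.FRationalResolution

end
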